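/-
Copyright: b2b-lace packet (lean typing seat 1, gen 43).  [NoBLE17] §5.3.2 (5.40)/(5.41): the slot right-hand sides
divided by one power of the bond parameter are still NONDECREASING in it ("slot over p"), the monotonicity used when a
column-`b = 1` cell of the averaged `Ā`-element — `((2d)·p)⁻¹ × slot(p)`, [FvdH17] App. B p. 78 `Ā^{ι,a,1} = (1/p) A^{ι,a,1}`
with §6.1 p. 59 — is read off at a majorant of `p`.  Proofs only; no named fact; no numeral; no dimension.
-/
import Literature.Probability.FitznerVanDerHofstad2017.NobleTriangleLetterSums
import HarnessLib

/-!
# [NoBLE17] (5.40)/(5.41) — the slots over one power of `p` are nondecreasing in the letter parameters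

Source: R. Fitzner, R. van der Hofstad, *Generalized approach to the non-backtracking lace expansion*, Probab. Theory
Relat. Fields **169** (2017) [FitznerVanDerHofstad2016NoBLE], §5.3.2 (5.40) (bubble) and (5.41) (triangle), p. 1098,
landed as the total real functions `bubbleSlotR p Γ̄ m₁ m₂ M N R₁ R₂` (`NobleBubbleLetterSums`) and
`triangleSlotR p Γ̄ m₁ m₂ m₃ M N R₁ R₂ R₃` (`NobleTriangleLetterSums`); R. Fitzner, R. van der Hofstad, *Mean-field
behavior for nearest-neighbor percolation in `d > 10`*, EJP **22** (2017) [FvdH17], arXiv:1506.07977v2 App. B p. 78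
(`Ā^{ι,a,1} = (1/p) A^{ι,a,1}`) with §6.1 p. 59 and §5.1 p. 49: the column `b = 1` of the averaged double-open element is
priced `((2d)·p)⁻¹ × slot(p)` (`NobleEntryAbarAvgColOne`, `NobleGapSliceSymm` §E).

## What this module proves (kernel-checked; no cited hypothesis; no dimension, no numerical value)

Every monomial of `bubbleSlotR p Γ̄ m₁ m₂ M N R₁ R₂` has `p`-degree `L ≥ m₁ + m₂` (the trail-word sum over
`L ∈ [m₁+m₂, M)`) or `= M` (the two remainder tails), so once `1 ≤ m₁ + m₂` and `1 ≤ M` the quotient by one power of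
`p` is a polynomial with non-negative coefficients in `(p, Γ̄, R₁, R₂)` on the non-negative orthant; likewise
`triangleSlotR` with `1 ≤ m₁ + m₂ + m₃`, `1 ≤ M`.  Hence, for `0 ≤ p ≤ p'`, `0 ≤ Γ̄ ≤ Γ̄'`, `0 ≤ Rᵢ ≤ Rᵢ'`:

* **`p' · bubbleSlotR p Γ̄ … R₁ R₂ ≤ p · bubbleSlotR p' Γ̄' … R₁' R₂'`** (`mul_bubbleSlotR_le_mul_bubbleSlotR`), the
  division form `bubbleSlotR p … / p ≤ bubbleSlotR p' … / p'` for `0 < p` (`bubbleSlotR_div_le_div`), and the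
  consumer's `ℝ≥0∞` form **`(c · ofReal p)⁻¹ · ofReal (bubbleSlotR p …) ≤ (c · ofReal p')⁻¹ · ofReal (bubbleSlotR p' …)`**
  for `0 < p` and any finite `c` (`inv_mul_ofReal_bubbleSlotR_mono`; `c = 2d` in the column-`1` cells);
* the same three statements for `triangleSlotR` (`1 ≤ m₁ + m₂ + m₃`, `1 ≤ M`).

Companions of the count-monotonicity `bubbleSlotR_mono_count` / `triangleSlotR_mono_count`; NOT derivable from plain
monotonicity of the slot composed with a bound on the antitone prefactor `p⁻¹`.  Any `d` (none appears); nothing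
landed is modified; no cited hypothesis; no numeral; no `def`.
-/

namespace Literature.Probability.FitznerVanDerHofstad2017.NobleBlocks

open Finset
open scoped BigOperators ENNReal

/-! ## A. One power of `p` against a monomial -/

/-- For `0 ≤ p ≤ p'` and `1 ≤ L`: `p' · p^L ≤ p · p'^L` (both sides are `p·p'·(·)^{L−1}`).
[cite: FitznerVanDerHofstad2016NoBLE, §5.3.2 (5.40) (PTRF 169 (2017) p. 1098)] -/
theorem mul_pow_le_mul_pow_of_le {p p' : ℝ} (hp : 0 ≤ p) (hpp' : p ≤ p') {L : ℕ} (hL : 1 ≤ L) :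
    p' * p ^ L ≤ p * p' ^ L := by
  obtain ⟨K, rfl⟩ : ∃ K, L = K + 1 := ⟨L - 1, by omega⟩
  have hp' : 0 ≤ p' := hp.trans hpp'
  calc p' * p ^ (K + 1) = p * p' * p ^ K := by ring
    _ ≤ p * p' * p' ^ K := mul_le_mul_of_nonneg_left (pow_le_pow_left₀ hp hpp' K) (mul_nonneg hp hp')
    _ = p * p' ^ (K + 1) := by ring

/-! ## B. The (5.40) slot -/

/-- **Slot over `p`, (5.40)**: for `0 ≤ p ≤ p'`, `0 ≤ Γ̄ ≤ Γ̄'`, `0 ≤ R₁ ≤ R₁'`, `0 ≤ R₂ ≤ R₂'`, `1 ≤ m₁ + m₂`, `1 ≤ M`: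
`p' · bubbleSlotR p Γ̄ m₁ m₂ M N R₁ R₂ ≤ p · bubbleSlotR p' Γ̄' m₁ m₂ M N R₁' R₂'`.
[cite: FitznerVanDerHofstad2016NoBLE, §5.3.2 (5.40) (PTRF 169 (2017) p. 1098)] -/
theorem mul_bubbleSlotR_le_mul_bubbleSlotR {p p' Γ Γ' R₁ R₁' R₂ R₂' : ℝ} (hp : 0 ≤ p) (hpp' : p ≤ p')
    (hΓ : 0 ≤ Γ) (hΓΓ' : Γ ≤ Γ') (hR₁ : 0 ≤ R₁) (hR₁' : R₁ ≤ R₁') (hR₂ : 0 ≤ R₂) (hR₂' : R₂ ≤ R₂')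
    {m₁ m₂ M : ℕ} (hm : 1 ≤ m₁ + m₂) (hM : 1 ≤ M) (N : ℕ → ℕ) :
    p' * bubbleSlotR p Γ m₁ m₂ M N R₁ R₂ ≤ p * bubbleSlotR p' Γ' m₁ m₂ M N R₁' R₂' := by
  have hp' : 0 ≤ p' := hp.trans hpp'
  have hΓ' : 0 ≤ Γ' := hΓ.trans hΓΓ'
  have hR₁'' : 0 ≤ R₁' := hR₁.trans hR₁'
  have hR₂'' : 0 ≤ R₂' := hR₂.trans hR₂'
  have hM' : p' * p ^ M ≤ p * p' ^ M := mul_pow_le_mul_pow_of_le hp hpp' hM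
  unfold bubbleSlotR
  rw [mul_add, mul_add, mul_add, mul_add, Finset.mul_sum, Finset.mul_sum]
  apply add_le_add
  apply add_le_add
  · apply Finset.sum_le_sum
    intro L hL
    have hL1 : 1 ≤ L := hm.trans (Finset.mem_Ico.mp hL).1
    calc p' * (((L + 1 - m₁ - m₂ : ℕ) : ℝ) * (N L : ℝ) * p ^ L)
        = ((L + 1 - m₁ - m₂ : ℕ) : ℝ) * (N L : ℝ) * (p' * p ^ L) := by ring
      _ ≤ ((L + 1 - m₁ - m₂ : ℕ) : ℝ) * (N L : ℝ) * (p * p' ^ L) :=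
          mul_le_mul_of_nonneg_left (mul_pow_le_mul_pow_of_le hp hpp' hL1) (by positivity)
      _ = p * (((L + 1 - m₁ - m₂ : ℕ) : ℝ) * (N L : ℝ) * p' ^ L) := by ring
  · calc p' * (((M - m₁ - m₂ : ℕ) : ℝ) * (p ^ M * (Γ * R₁)))
        = ((M - m₁ - m₂ : ℕ) : ℝ) * ((p' * p ^ M) * (Γ * R₁)) := by ring
      _ ≤ ((M - m₁ - m₂ : ℕ) : ℝ) * ((p * p' ^ M) * (Γ' * R₁')) :=
          mul_le_mul_of_nonneg_left (mul_le_mul hM' (mul_le_mul hΓΓ' hR₁' hR₁ hΓ') (mul_nonneg hΓ hR₁)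
            (mul_nonneg hp (pow_nonneg hp' M))) (by positivity)
      _ = p * (((M - m₁ - m₂ : ℕ) : ℝ) * (p' ^ M * (Γ' * R₁'))) := by ring
  · calc p' * (p ^ M * (Γ ^ 2 * R₂)) = (p' * p ^ M) * (Γ ^ 2 * R₂) := by ring
      _ ≤ (p * p' ^ M) * (Γ' ^ 2 * R₂') :=
          mul_le_mul hM' (mul_le_mul (pow_le_pow_left₀ hΓ hΓΓ' 2) hR₂' hR₂ (pow_nonneg hΓ' 2))
            (mul_nonneg (pow_nonneg hΓ 2) hR₂) (mul_nonneg hp (pow_nonneg hp' M))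
      _ = p * (p' ^ M * (Γ' ^ 2 * R₂')) := by ring

/-- Division form of the (5.40) slot over `p` (`0 < p ≤ p'`).
[cite: FitznerVanDerHofstad2016NoBLE, §5.3.2 (5.40) (PTRF 169 (2017) p. 1098)] -/
theorem bubbleSlotR_div_le_div {p p' Γ Γ' R₁ R₁' R₂ R₂' : ℝ} (hp : 0 < p) (hpp' : p ≤ p')
    (hΓ : 0 ≤ Γ) (hΓΓ' : Γ ≤ Γ') (hR₁ : 0 ≤ R₁) (hR₁' : R₁ ≤ R₁') (hR₂ : 0 ≤ R₂) (hR₂' : R₂ ≤ R₂')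
    {m₁ m₂ M : ℕ} (hm : 1 ≤ m₁ + m₂) (hM : 1 ≤ M) (N : ℕ → ℕ) :
    bubbleSlotR p Γ m₁ m₂ M N R₁ R₂ / p ≤ bubbleSlotR p' Γ' m₁ m₂ M N R₁' R₂' / p' := by
  rw [div_le_div_iff₀ hp (hp.trans_le hpp'), mul_comm]
  simpa [mul_comm] using mul_bubbleSlotR_le_mul_bubbleSlotR hp.le hpp' hΓ hΓΓ' hR₁ hR₁' hR₂ hR₂' hm hM N

/-- **Consumer form in `ℝ≥0∞`** (`c` finite, e.g. `c = 2d`): for `0 < p ≤ p'` and monotone letters,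
`(c · ofReal p)⁻¹ · ofReal (bubbleSlotR p …) ≤ (c · ofReal p')⁻¹ · ofReal (bubbleSlotR p' …)` (`1 ≤ m₁ + m₂`, `1 ≤ M`).
[cite: FitznerVanDerHofstad2016NoBLE, §5.3.2 (5.40) (PTRF 169 (2017) p. 1098)]
[cite: FitznerVanDerHofstad2017, App. B display "Ā^{ι,a,1} = (1/p) A^{ι,a,1}" (arXiv:1506.07977v2 p. 78) with §6.1 p. 59] -/
theorem inv_mul_ofReal_bubbleSlotR_mono {c : ℝ≥0∞} (hc : c ≠ ∞) {p p' Γ Γ' R₁ R₁' R₂ R₂' : ℝ} (hp : 0 < p)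
    (hpp' : p ≤ p') (hΓ : 0 ≤ Γ) (hΓΓ' : Γ ≤ Γ') (hR₁ : 0 ≤ R₁) (hR₁' : R₁ ≤ R₁') (hR₂ : 0 ≤ R₂)
    (hR₂' : R₂ ≤ R₂') {m₁ m₂ M : ℕ} (hm : 1 ≤ m₁ + m₂) (hM : 1 ≤ M) (N : ℕ → ℕ) :
    (c * ENNReal.ofReal p)⁻¹ * ENNReal.ofReal (bubbleSlotR p Γ m₁ m₂ M N R₁ R₂) ≤
      (c * ENNReal.ofReal p')⁻¹ * ENNReal.ofReal (bubbleSlotR p' Γ' m₁ m₂ M N R₁' R₂') := by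
  have hp' : 0 < p' := hp.trans_le hpp'
  have key : ∀ {q : ℝ}, 0 < q → ∀ S : ℝ, 0 ≤ S →
      (c * ENNReal.ofReal q)⁻¹ * ENNReal.ofReal S = c⁻¹ * ENNReal.ofReal (S / q) := by
    intro q hq S hS
    rw [ENNReal.mul_inv (Or.inr ENNReal.ofReal_ne_top) (Or.inl hc), mul_assoc,
      ENNReal.ofReal_div_of_pos hq, div_eq_mul_inv, mul_comm (ENNReal.ofReal S)]
  rw [key hp _ (bubbleSlotR_nonneg hp.le hΓ m₁ m₂ M N hR₁ hR₂),
    key hp' _ (bubbleSlotR_nonneg hp'.le (hΓ.trans hΓΓ') m₁ m₂ M N (hR₁.trans hR₁') (hR₂.trans hR₂'))]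
  exact mul_le_mul' le_rfl (ENNReal.ofReal_le_ofReal
    (bubbleSlotR_div_le_div hp hpp' hΓ hΓΓ' hR₁ hR₁' hR₂ hR₂' hm hM N))

/-! ## C. The (5.41) slot -/

/-- **Slot over `p`, (5.41)**: for `0 ≤ p ≤ p'`, `0 ≤ Γ̄ ≤ Γ̄'`, `0 ≤ Rᵢ ≤ Rᵢ'`, `1 ≤ m₁ + m₂ + m₃`, `1 ≤ M`:
`p' · triangleSlotR p Γ̄ m₁ m₂ m₃ M N R₁ R₂ R₃ ≤ p · triangleSlotR p' Γ̄' m₁ m₂ m₃ M N R₁' R₂' R₃'`.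
[cite: FitznerVanDerHofstad2016NoBLE, §5.3.2 (5.41) (PTRF 169 (2017) p. 1098)] -/
theorem mul_triangleSlotR_le_mul_triangleSlotR {p p' Γ Γ' R₁ R₁' R₂ R₂' R₃ R₃' : ℝ} (hp : 0 ≤ p)
    (hpp' : p ≤ p') (hΓ : 0 ≤ Γ) (hΓΓ' : Γ ≤ Γ') (hR₁ : 0 ≤ R₁) (hR₁' : R₁ ≤ R₁') (hR₂ : 0 ≤ R₂)
    (hR₂' : R₂ ≤ R₂') (hR₃ : 0 ≤ R₃) (hR₃' : R₃ ≤ R₃') {m₁ m₂ m₃ M : ℕ} (hm : 1 ≤ m₁ + m₂ + m₃)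
    (hM : 1 ≤ M) (N : ℕ → ℕ) :
    p' * triangleSlotR p Γ m₁ m₂ m₃ M N R₁ R₂ R₃ ≤ p * triangleSlotR p' Γ' m₁ m₂ m₃ M N R₁' R₂' R₃' := by
  have hp' : 0 ≤ p' := hp.trans hpp'
  have hΓ' : 0 ≤ Γ' := hΓ.trans hΓΓ'
  have hR₁'' : 0 ≤ R₁' := hR₁.trans hR₁'
  have hR₂'' : 0 ≤ R₂' := hR₂.trans hR₂'
  have hR₃'' : 0 ≤ R₃' := hR₃.trans hR₃'
  have hM' : p' * p ^ M ≤ p * p' ^ M := mul_pow_le_mul_pow_of_le hp hpp' hM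
  have hΓpow : ∀ n : ℕ, Γ ^ n ≤ Γ' ^ n := fun n => pow_le_pow_left₀ hΓ hΓΓ' n
  have hpp'M : 0 ≤ p * p' ^ M := mul_nonneg hp (pow_nonneg hp' M)
  unfold triangleSlotR
  rw [mul_add, mul_add, mul_add, mul_add, mul_add, mul_add, Finset.mul_sum, Finset.mul_sum]
  apply add_le_add
  apply add_le_add
  apply add_le_add
  · apply Finset.sum_le_sum
    intro L hL
    have hL1 : 1 ≤ L := hm.trans (Finset.mem_Ico.mp hL).1
    calc p' * ((((L + 2 - (m₁ + m₂ + m₃)).choose 2 : ℕ) : ℝ) * (N L : ℝ) * p ^ L)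
        = (((L + 2 - (m₁ + m₂ + m₃)).choose 2 : ℕ) : ℝ) * (N L : ℝ) * (p' * p ^ L) := by ring
      _ ≤ (((L + 2 - (m₁ + m₂ + m₃)).choose 2 : ℕ) : ℝ) * (N L : ℝ) * (p * p' ^ L) :=
          mul_le_mul_of_nonneg_left (mul_pow_le_mul_pow_of_le hp hpp' hL1) (by positivity)
      _ = p * ((((L + 2 - (m₁ + m₂ + m₃)).choose 2 : ℕ) : ℝ) * (N L : ℝ) * p' ^ L) := by ring
  · calc p' * ((((M + 1 - (m₁ + m₂ + m₃)).choose 2 : ℕ) : ℝ) * (p ^ M * (Γ * R₁)))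
        = (((M + 1 - (m₁ + m₂ + m₃)).choose 2 : ℕ) : ℝ) * ((p' * p ^ M) * (Γ * R₁)) := by ring
      _ ≤ (((M + 1 - (m₁ + m₂ + m₃)).choose 2 : ℕ) : ℝ) * ((p * p' ^ M) * (Γ' * R₁')) :=
          mul_le_mul_of_nonneg_left (mul_le_mul hM' (mul_le_mul hΓΓ' hR₁' hR₁ hΓ') (mul_nonneg hΓ hR₁) hpp'M)
            (by positivity)
      _ = p * ((((M + 1 - (m₁ + m₂ + m₃)).choose 2 : ℕ) : ℝ) * (p' ^ M * (Γ' * R₁'))) := by ring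
  · calc p' * (((M - (m₁ + m₂ + m₃) : ℕ) : ℝ) * (p ^ M * (Γ ^ 2 * R₂)))
        = ((M - (m₁ + m₂ + m₃) : ℕ) : ℝ) * ((p' * p ^ M) * (Γ ^ 2 * R₂)) := by ring
      _ ≤ ((M - (m₁ + m₂ + m₃) : ℕ) : ℝ) * ((p * p' ^ M) * (Γ' ^ 2 * R₂')) :=
          mul_le_mul_of_nonneg_left (mul_le_mul hM' (mul_le_mul (hΓpow 2) hR₂' hR₂ (pow_nonneg hΓ' 2))
            (mul_nonneg (pow_nonneg hΓ 2) hR₂) hpp'M) (by positivity)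
      _ = p * (((M - (m₁ + m₂ + m₃) : ℕ) : ℝ) * (p' ^ M * (Γ' ^ 2 * R₂'))) := by ring
  · calc p' * (p ^ M * (Γ ^ 3 * R₃)) = (p' * p ^ M) * (Γ ^ 3 * R₃) := by ring
      _ ≤ (p * p' ^ M) * (Γ' ^ 3 * R₃') :=
          mul_le_mul hM' (mul_le_mul (hΓpow 3) hR₃' hR₃ (pow_nonneg hΓ' 3))
            (mul_nonneg (pow_nonneg hΓ 3) hR₃) hpp'M
      _ = p * (p' ^ M * (Γ' ^ 3 * R₃')) := by ring

/-- Division form of the (5.41) slot over `p` (`0 < p ≤ p'`).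
[cite: FitznerVanDerHofstad2016NoBLE, §5.3.2 (5.41) (PTRF 169 (2017) p. 1098)] -/
theorem triangleSlotR_div_le_div {p p' Γ Γ' R₁ R₁' R₂ R₂' R₃ R₃' : ℝ} (hp : 0 < p) (hpp' : p ≤ p')
    (hΓ : 0 ≤ Γ) (hΓΓ' : Γ ≤ Γ') (hR₁ : 0 ≤ R₁) (hR₁' : R₁ ≤ R₁') (hR₂ : 0 ≤ R₂) (hR₂' : R₂ ≤ R₂')
    (hR₃ : 0 ≤ R₃) (hR₃' : R₃ ≤ R₃') {m₁ m₂ m₃ M : ℕ} (hm : 1 ≤ m₁ + m₂ + m₃) (hM : 1 ≤ M) (N : ℕ → ℕ) :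
    triangleSlotR p Γ m₁ m₂ m₃ M N R₁ R₂ R₃ / p ≤ triangleSlotR p' Γ' m₁ m₂ m₃ M N R₁' R₂' R₃' / p' := by
  rw [div_le_div_iff₀ hp (hp.trans_le hpp'), mul_comm]
  simpa [mul_comm] using
    mul_triangleSlotR_le_mul_triangleSlotR hp.le hpp' hΓ hΓΓ' hR₁ hR₁' hR₂ hR₂' hR₃ hR₃' hm hM N

/-- **Consumer form in `ℝ≥0∞`** for the (5.41) slot (`c` finite): for `0 < p ≤ p'` and monotone letters,
`(c · ofReal p)⁻¹ · ofReal (triangleSlotR p …) ≤ (c · ofReal p')⁻¹ · ofReal (triangleSlotR p' …)`.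
[cite: FitznerVanDerHofstad2016NoBLE, §5.3.2 (5.41) (PTRF 169 (2017) p. 1098)]
[cite: FitznerVanDerHofstad2017, App. B display "Ā^{ι,a,1} = (1/p) A^{ι,a,1}" (arXiv:1506.07977v2 p. 78) with §6.1 p. 59] -/
theorem inv_mul_ofReal_triangleSlotR_mono {c : ℝ≥0∞} (hc : c ≠ ∞) {p p' Γ Γ' R₁ R₁' R₂ R₂' R₃ R₃' : ℝ}
    (hp : 0 < p) (hpp' : p ≤ p') (hΓ : 0 ≤ Γ) (hΓΓ' : Γ ≤ Γ') (hR₁ : 0 ≤ R₁) (hR₁' : R₁ ≤ R₁')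
    (hR₂ : 0 ≤ R₂) (hR₂' : R₂ ≤ R₂') (hR₃ : 0 ≤ R₃) (hR₃' : R₃ ≤ R₃') {m₁ m₂ m₃ M : ℕ}
    (hm : 1 ≤ m₁ + m₂ + m₃) (hM : 1 ≤ M) (N : ℕ → ℕ) :
    (c * ENNReal.ofReal p)⁻¹ * ENNReal.ofReal (triangleSlotR p Γ m₁ m₂ m₃ M N R₁ R₂ R₃) ≤
      (c * ENNReal.ofReal p')⁻¹ * ENNReal.ofReal (triangleSlotR p' Γ' m₁ m₂ m₃ M N R₁' R₂' R₃') := by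
  have hp' : 0 < p' := hp.trans_le hpp'
  have key : ∀ {q : ℝ}, 0 < q → ∀ S : ℝ, 0 ≤ S →
      (c * ENNReal.ofReal q)⁻¹ * ENNReal.ofReal S = c⁻¹ * ENNReal.ofReal (S / q) := by
    intro q hq S hS
    rw [ENNReal.mul_inv (Or.inr ENNReal.ofReal_ne_top) (Or.inl hc), mul_assoc,
      ENNReal.ofReal_div_of_pos hq, div_eq_mul_inv, mul_comm (ENNReal.ofReal S)]
  rw [key hp _ (triangleSlotR_nonneg hp.le hΓ m₁ m₂ m₃ M N hR₁ hR₂ hR₃),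
    key hp' _ (triangleSlotR_nonneg hp'.le (hΓ.trans hΓΓ') m₁ m₂ m₃ M N (hR₁.trans hR₁') (hR₂.trans hR₂')
      (hR₃.trans hR₃'))]
  exact mul_le_mul' le_rfl (ENNReal.ofReal_le_ofReal
    (triangleSlotR_div_le_div hp hpp' hΓ hΓΓ' hR₁ hR₁' hR₂ hR₂' hR₃ hR₃' hm hM N))

end Literature.Probability.FitznerVanDerHofstad2017.NobleBlocks
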